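import Summits.Ventures.HodgeRepro2.T5SU11SphericalLp

/-!
# Harish-Chandra's `c`-function of `SU(1,1)`: positivity, the bounds `c(λ) ≤ 1` (`λ ≤ 0`), `c(λ) ≥ 1`
(`0 ≤ λ < 1`), and monotonicity on `(-∞, 1)`

For the `c`-function `cfun λ = (2π)⁻¹ ∫_{-π}^{π} ((1 - cos φ)/2)^{-λ/2} dφ` of
`T5SU11SphericalAsymptotic` (`λ < 1`), the limit integrand `cLimit λ φ = ((1 - cos φ)/2)^{-λ/2}` is
positive off `φ = 0` (`cLimit_pos`), at most `1` for `λ ≤ 0` (`cLimit_le_one`), at least `1` for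
`λ ≥ 0` off `φ = 0` (`one_le_cLimit`), and monotone in `λ` (`cLimit_mono`: the base `(1 - cos φ)/2` lies
in `(0, 1]`). Integrating over `(-π, π)`: **`c(λ) > 0` for every `λ < 1`** (`cfun_pos`,
`intervalIntegral.integral_pos_iff_support_of_nonneg_ae`), **`c(λ) ≤ 1` for `λ ≤ 0`** (`cfun_le_one`),
**`c(λ) ≥ 1` for `0 ≤ λ < 1`** (`one_le_cfun`), and **`c` is monotone on `(-∞, 1)`** (`cfun_mono`). As a
consequence the leading coefficient of the asymptotics `e^{λt} sph λ (a_t) → c(λ)` is positive, so that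
for `λ < 1` the spherical function `sph λ (a_t)` is eventually bounded below by `(c(λ)/2) e^{-λt}`
(`eventually_sph_hyp_ge`) — the lower bound matching the upper bound of `T5SU11SphericalLp`. Nothing is
claimed about (N).

Blind lane: Mathlib + the HodgeRepro2 prefix only; no sorry; axioms ⊆ {propext, Classical.choice,
Quot.sound}.
-/

namespace Summit.Ventures.HodgeRepro2.T5SU11SphericalCfun

open MeasureTheory Metric Set Filter Topology Complex intervalIntegral
open T5SU11Unimodular T5SU11Fibration T5SU11Cartan T5SU11OneParameter T5SU11CartanProjection
  T5HaarCircle T5SU11SphericalFunction T5SU11SphericalTwo T5SU11SphericalSymmetry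
  T5SU11SphericalBounds T5SU11SphericalContinuous T5SU11SphericalAsymptotic T5SU11SphericalLp
open scoped Real ENNReal

/-! ### Pointwise bounds on the limit integrand -/

/-- `cos φ < 1` for `φ ∈ [-π, π]`, `φ ≠ 0`. -/
lemma cos_lt_one_of_ne_zero {φ : ℝ} (h1 : -π ≤ φ) (h2 : φ ≤ π) (hφ : φ ≠ 0) : Real.cos φ < 1 := by
  rcases h1.lt_or_eq with h1 | h1
  · rcases (Real.cos_le_one φ).lt_or_eq with h | h
    · exact h
    · exfalso
      exact hφ ((Real.cos_eq_one_iff_of_lt_of_lt (by linarith) (by linarith)).mp h)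
  · rw [← h1, Real.cos_neg, Real.cos_pi]
    norm_num

/-- `(1 - cos φ)/2 ≤ 1`. -/
lemma one_sub_cos_div_two_le_one (φ : ℝ) : (1 - Real.cos φ) / 2 ≤ 1 := by
  linarith [Real.neg_one_le_cos φ]

/-- `cLimit λ φ > 0` for `φ ∈ [-π, π]`, `φ ≠ 0`. -/
lemma cLimit_pos (lam : ℝ) {φ : ℝ} (h1 : -π ≤ φ) (h2 : φ ≤ π) (hφ : φ ≠ 0) : 0 < cLimit lam φ :=
  Real.rpow_pos_of_pos (by linarith [cos_lt_one_of_ne_zero h1 h2 hφ]) _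

/-- `cLimit λ φ ≤ 1` for `λ ≤ 0`. -/
lemma cLimit_le_one {lam : ℝ} (hlam : lam ≤ 0) (φ : ℝ) : cLimit lam φ ≤ 1 :=
  Real.rpow_le_one (by linarith [Real.cos_le_one φ]) (one_sub_cos_div_two_le_one φ) (by linarith)

/-- `1 ≤ cLimit λ φ` for `λ ≥ 0` and `φ ∈ [-π, π]`, `φ ≠ 0`. -/
lemma one_le_cLimit {lam : ℝ} (hlam : 0 ≤ lam) {φ : ℝ} (h1 : -π ≤ φ) (h2 : φ ≤ π) (hφ : φ ≠ 0) :
    1 ≤ cLimit lam φ :=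
  Real.one_le_rpow_of_pos_of_le_one_of_nonpos (by linarith [cos_lt_one_of_ne_zero h1 h2 hφ])
    (one_sub_cos_div_two_le_one φ) (by linarith)

/-- **`cLimit` is monotone in `λ`** off `φ = 0`: `λ₁ ≤ λ₂ → cLimit λ₁ φ ≤ cLimit λ₂ φ`. -/
lemma cLimit_mono {l₁ l₂ : ℝ} (hl : l₁ ≤ l₂) {φ : ℝ} (h1 : -π ≤ φ) (h2 : φ ≤ π) (hφ : φ ≠ 0) :
    cLimit l₁ φ ≤ cLimit l₂ φ :=
  Real.rpow_le_rpow_of_exponent_ge (by linarith [cos_lt_one_of_ne_zero h1 h2 hφ])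
    (one_sub_cos_div_two_le_one φ) (by linarith)

/-- The null set `{0}`: almost every real number is non-zero. -/
lemma ae_ne_zero : ∀ᵐ φ ∂(volume : Measure ℝ), φ ≠ 0 := by
  rw [ae_iff]
  simp only [not_not, Set.setOf_eq_eq_singleton]
  exact Real.volume_singleton

/-! ### The `c`-function -/

/-- **`c(λ) > 0` for every `λ < 1`.** -/
theorem cfun_pos {lam : ℝ} (hlam : lam < 1) : 0 < cfun lam := by
  have hπ := Real.pi_pos
  refine mul_pos (by positivity) ?_
  rw [integral_pos_iff_support_of_nonneg_ae (Filter.Eventually.of_forall (cLimit_nonneg lam))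
    (intervalIntegrable_cLimit hlam)]
  refine ⟨by linarith, ?_⟩
  have hsub : Ioo 0 π ⊆ Function.support (cLimit lam) ∩ Ioc (-π) π := by
    intro φ hφ
    refine ⟨?_, ⟨by linarith [hφ.1], hφ.2.le⟩⟩
    rw [Function.mem_support]
    exact (cLimit_pos lam (by linarith [hφ.1]) hφ.2.le hφ.1.ne').ne'
  refine lt_of_lt_of_le ?_ (measure_mono hsub)
  rw [Real.volume_Ioo, sub_zero]
  exact ENNReal.ofReal_pos.mpr hπ

/-- **`c(λ) ≤ 1` for `λ ≤ 0`.** -/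
theorem cfun_le_one {lam : ℝ} (hlam : lam ≤ 0) : cfun lam ≤ 1 := by
  have hπ := Real.pi_pos
  have h : ∫ φ in (-π)..π, cLimit lam φ ≤ ∫ φ in (-π)..π, (1 : ℝ) :=
    integral_mono_on (by linarith) (intervalIntegrable_cLimit (by linarith)) intervalIntegrable_const
      fun φ _ => cLimit_le_one hlam φ
  rw [intervalIntegral.integral_const, smul_eq_mul, mul_one] at h
  unfold cfun
  calc (2 * π)⁻¹ * ∫ φ in (-π)..π, cLimit lam φ ≤ (2 * π)⁻¹ * (π - -π) :=
        mul_le_mul_of_nonneg_left h (by positivity)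
    _ = 1 := by
        rw [show π - -π = 2 * π by ring, inv_mul_cancel₀ (by positivity)]

/-- **`c(λ) ≥ 1` for `0 ≤ λ < 1`.** -/
theorem one_le_cfun {lam : ℝ} (h0 : 0 ≤ lam) (h1 : lam < 1) : 1 ≤ cfun lam := by
  have hπ := Real.pi_pos
  have h : ∫ φ in (-π)..π, (1 : ℝ) ≤ ∫ φ in (-π)..π, cLimit lam φ := by
    refine integral_mono_ae_restrict (by linarith) intervalIntegrable_const
      (intervalIntegrable_cLimit h1) ?_
    rw [Filter.EventuallyLE, ae_restrict_iff' measurableSet_Icc]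
    filter_upwards [ae_ne_zero] with φ hφ hmem
    exact one_le_cLimit h0 hmem.1 hmem.2 hφ
  rw [intervalIntegral.integral_const, smul_eq_mul, mul_one] at h
  unfold cfun
  calc (1 : ℝ) = (2 * π)⁻¹ * (π - -π) := by
        rw [show π - -π = 2 * π by ring, inv_mul_cancel₀ (by positivity)]
    _ ≤ (2 * π)⁻¹ * ∫ φ in (-π)..π, cLimit lam φ :=
        mul_le_mul_of_nonneg_left h (by positivity)

/-- **`c` is monotone on `(-∞, 1)`**: `λ₁ ≤ λ₂ < 1 → c(λ₁) ≤ c(λ₂)`. -/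
theorem cfun_mono {l₁ l₂ : ℝ} (hl : l₁ ≤ l₂) (h2 : l₂ < 1) : cfun l₁ ≤ cfun l₂ := by
  have hπ := Real.pi_pos
  have h : ∫ φ in (-π)..π, cLimit l₁ φ ≤ ∫ φ in (-π)..π, cLimit l₂ φ := by
    refine integral_mono_ae_restrict (by linarith) (intervalIntegrable_cLimit (by linarith))
      (intervalIntegrable_cLimit h2) ?_
    rw [Filter.EventuallyLE, ae_restrict_iff' measurableSet_Icc]
    filter_upwards [ae_ne_zero] with φ hφ hmem
    exact cLimit_mono hl hmem.1 hmem.2 hφ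
  unfold cfun
  exact mul_le_mul_of_nonneg_left h (by positivity)

/-! ### The lower bound on the spherical functions -/

section measure

variable [MeasurableSpace Circle] [BorelSpace Circle]

/-- **The eventual lower bound**: for `λ < 1`, `sph λ (a_t) ≥ (c(λ)/2) e^{-λt}` for all large `t`. -/
theorem eventually_sph_hyp_ge {lam : ℝ} (hlam : lam < 1) :
    ∀ᶠ t : ℝ in atTop, cfun lam / 2 * Real.exp (-(lam * t)) ≤ sph lam (hyp t) := by
  have hc := cfun_pos hlam
  filter_upwards [(tendsto_exp_mul_sph_hyp hlam).eventually_const_le (half_lt_self hc)] with t ht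
  have hpos : 0 < Real.exp (lam * t) := Real.exp_pos _
  rw [Real.exp_neg, ← div_eq_mul_inv, div_le_iff₀ hpos, mul_comm]
  exact ht

/-- **The eventual lower bound on the other side**: for `λ > 1`, `sph λ (a_t) ≥ (c(2-λ)/2) e^{(λ-2)t}`
for all large `t` (so the exponent `λ - 2` of `T5SU11SphericalLp.exists_sph_le_norm_mat_inv_rpow` is
sharp). -/
theorem eventually_sph_hyp_ge_of_one_lt {lam : ℝ} (hlam : 1 < lam) :
    ∀ᶠ t : ℝ in atTop, cfun (2 - lam) / 2 * Real.exp (-((2 - lam) * t)) ≤ sph lam (hyp t) := by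
  have := eventually_sph_hyp_ge (lam := 2 - lam) (by linarith)
  simpa only [← sph_two_sub lam] using this

end measure

end Summit.Ventures.HodgeRepro2.T5SU11SphericalCfun
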